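import Mathlib.Analysis.InnerProductSpace.l2Space
import Mathlib.Analysis.Calculus.ContDiff.Basic
import Mathlib.Analysis.Calculus.ContDiff.Comp
import Mathlib.RepresentationTheory.Basic
import Mathlib.Topology.Algebra.InfiniteSum.Basic
import Mathlib.Topology.Algebra.InfiniteSum.Ring
import Mathlib.Algebra.BigOperators.Fin
import Mathlib.Data.Fin.VecNotation
import Literature.MathematicalPhysics.StatisticalMechanics.TensorRGMap
import HarnessLib

/-!
# Tensor RG maps with boundaries and corners: open-rectangle networks and the interface
# `TensorRGBoundaryMap`

Topic `MathematicalPhysics/StatisticalMechanics`; namespace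
`Literature.MathematicalPhysics.StatisticalMechanics`. Definition request `defn-TensorRGBoundaryMap`
of route CriticalPhenomena/CardyTensorRG (wanted by the cruxes `BoundaryTwistTensors`,
stmt-CriticalPhenomena-7100, and `RGToCrossingLaw`, stmt-CriticalPhenomena-7101): the
**boundary/corner extension** of the landed interface `TensorRGMap` (module
`Literature.MathematicalPhysics.StatisticalMechanics.TensorRGMap`, whose docstring lists this
extension under "Not here"). As there, NOTHING here asserts existence: the structure bundles data and
the axioms the route's statements consume; `TensorRGBoundaryMap.empty` shows they are consistent.

Setting. Bulk tensors are the Hilbert–Schmidt four-leg tensors `FourTensor = ℓ²(ℕ⁴)` of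
`TensorRGMap` (Kennedy–Rychkov 2022, §2: tensors "in an infinite-dimensional real Hilbert space `V`
with a countable basis", Hilbert–Schmidt norm), with the same weight-`w` dictionary (an element `B`
represents the tensor `B/√(w ⊗ ⋯ ⊗ w)`, whence a factor `(w e)⁻¹` per bond `e` in every partition
function). Open boundaries are treated as in the *boundary tensor renormalization group* of
Iino–Morita–Kawashima (2019, §2.1: "we hold three tensors: a rank-four bulk tensor `a` and two
rank-three boundary tensors `b₁` and `b₂` which respectively represent the two open edges … every two
tensors horizontally neighbouring is renormalized into one tensor", scale factor `2`), and corners as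
in Baxter's corner transfer matrices / the CTMRG of Nishino–Okunishi (1996, Eq. (5)–(7): the corner
transfer matrix "represents the Boltzmann weight for a quadrant (or corner) of the 2D lattice", the
half-row tensor `P` carries three indices): a rectangle with four open sides is the network of

* the bulk four-tensor `T` at each of the `m · n` bulk sites (legs (left, right, down, up), as in
  `torusTerm`);
* a **boundary three-tensor** on each of the `2m + 2n` boundary slots — one family per side,
  `B : Fin 4 → ThreeTensor` indexed (left, right, bottom, top) `= (0, 1, 2, 3)`, the same tensor at
  every slot of a side; legs (previous slot along the side, next slot along the side, into the bulk),
  "along the side" oriented towards increasing coordinate (upwards on the vertical sides, rightwards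
  on the horizontal sides);
* a **corner two-tensor** at each corner, `K : Fin 4 → TwoTensor` indexed (bottom-left,
  bottom-right, top-left, top-right) `= (0, 1, 2, 3)`; legs (bond along the horizontal side, bond
  along the vertical side);

every bond contracted. Concretely the network is the nearest-neighbour graph of the
`(m + 2) × (n + 2)` grid `Fin (m+2) × Fin (n+2)` with free boundary conditions: interior nodes carry
`T`, non-corner boundary nodes carry the `B`'s (degree `3`), corner nodes the `K`'s (degree `2`);
`RectEdge m n` is its edge set (`(m+1)(n+2)` horizontal and `(m+2)(n+1)` vertical bonds).

Contents.

* `ThreeIndex`/`ThreeTensor = ℓ²(ℕ³)`, `TwoIndex`/`TwoTensor = ℓ²(ℕ²)` (Hilbert–Schmidt, Mathlib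
  `lp _ 2`, inner product spaces over `ℝ`, complete).
* `RectEdge m n`, the leg maps `bulkLegs`, `leftLegs`, `rightLegs`, `bottomLegs`, `topLegs`,
  `cornerLegs`, the weight `rectTerm w m n T B K e` of a bond configuration `e : RectEdge m n → ℕ` and
  **the partition function of the open `m × n` rectangle** `rectPartition w m n T B K = ∑' e, rectTerm …`
  (unconditional `tsum`, `0` where not summable; for Hilbert–Schmidt data it is expected to be
  absolutely convergent by Cauchy–Schwarz along the bonds — an open rectangle has no self-contracted
  legs at any size, cf. EKR 2025 §2.2 quoting KR 2023 Prop. 2.3 for tori of side `≥ 2` — not proved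
  here).
* `sideLength m n = ![n, n, m, m]` (slots per side), `cornerHSide = ![2, 2, 3, 3]`,
  `cornerVSide = ![0, 1, 0, 1]` (the horizontal/vertical side adjacent to each corner),
  `SideInput = FourTensor × ThreeTensor`, `CornerInput = FourTensor × ThreeTensor × ThreeTensor ×
  TwoTensor` (bulk, boundary tensor of the adjacent horizontal side, of the adjacent vertical side,
  corner), `RectTensors` (bulk, four boundary tensors, four corner tensors) with `RectTensors.sideInput`,
  `RectTensors.cornerInput`.
* `TensorRGBoundaryMap w ρ extends TensorRGMap w ρ` — the INTERFACE: per side `s` an open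
  `bdomain s ⊆ SideInput`, the boundary map `bmap s : SideInput → ThreeTensor` (the coarse boundary
  tensor of side `s` produced from a PAIR of adjacent fine boundary tensors of side `s` and the
  adjacent bulk, IMK 2019 §2.1; it is a function of `(T, B s)` because the fine data are uniform along
  the side) and a positive scalar `bnormalization s`; per corner `c` an open `cdomain c ⊆ CornerInput`,
  the corner map `cmap c : CornerInput → TwoTensor` (coarse corner from the fine corner, its two
  neighbouring boundary tensors and the adjacent bulk block) and a positive `cnormalization c`; the
  **exact `2 × 2`-blocking covariance of open-rectangle partition functions**: for `m, n ≥ 1` and data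
  in the domains, `Z_{2m × 2n}(T, B, K) = 𝒩(T)^{m n} · ∏ₛ 𝒩ₛ(T, Bₛ)^{sideLength m n s} ·
  ∏_c 𝒩_c(…) · Z_{m × n}(𝓡 T, bmap, cmap)` (one coarse bulk tensor per `2 × 2` block, one coarse
  boundary tensor per pair of boundary slots, one coarse corner per corner — the defining property
  of an RG map, "that `Z` remains the same while the total number of tensors in the network gets
  reduced", Ebel–Kennedy–Rychkov 2025 §2.2, here for open rectangles; KR 2022 §1: "Our RG maps will
  preserve the partition function exactly"); and `C¹` regularity of `bmap s` on `bdomain s` and of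
  `cmap c` on `cdomain c`. The symmetry action `ρ` only enters through the parent (`ρ`-equivariance
  of the boundary data would need actions on `ThreeTensor`/`TwoTensor` permuting the sides; omitted —
  the typed crux `GaussianSaddleCertificate` uses the trivial group).
* API: `rectTerm`/`rectPartition` of the zero bulk tensor, of the empty rectangle; HOMOGENEITY
  `rectPartition w m n (a • T) B K = a ^ (m n) · rectPartition w m n T B K` and in the boundary /
  corner data, hence `rectPartition_smul_bulk_div`: a RATIO of two rectangle partition functions with
  the same bulk tensor and different boundary/corner data (crossing probabilities are such ratios —
  Cardy 1992; Bondesan–Jacobsen–Saleur 2012 for rectangular amplitudes with corner contributions) is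
  unchanged by the bulk normalisation `T ↦ a • T`; the bundled one-step form `TensorRGBoundaryMap.step`,
  `InDomain`, `bcFactor`, `factor`, `covariance_step`, `factor_pos`, and `covariance_ratio`: in the
  covariance identity for such a ratio the bulk factor `𝒩(T)^{m n}` cancels; `TensorRGBoundaryMap.empty`.

Design notes. (1) The covariance axiom keeps the coarse bulk UNIFORM (`map T` at every coarse
site, normalised by the same `𝒩(T)` as in the torus axiom of the parent): all boundary effects of
the blocking are absorbed into `bmap`/`cmap` and their normalisations. For the plain `2 × 2`
blocking followed by an isometry `V ⊗ V → V` on the coarse legs this is the evident bookkeeping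
(pairs of boundary tensors contracted along their shared bond, corners untouched); for maps with
gauge transformations or disentanglers the boundary tensors must also absorb what crosses the
bulk–boundary bonds, which is why `bmap s` and `cmap c` take the bulk tensor as an argument — and
whether a given bulk scheme admits such an extension near a given orbit is part of what a user of
this interface asserts, not something recorded here. (2) `m, n ≥ 1` in the covariance axiom: the
boundary maps see an adjacent bulk block. (3) Maps and normalisations are total functions; only
their values on the (open) domains are constrained, as in the parent.

Not here: any construction (HOTRG/BTRG projectors, disentanglers), existence on a neighbourhood of
the percolation orbit (crux `BoundaryTwistTensors`), summability of rectangle networks, the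
six-vertex boundary/twist tensors of Baxter–Kelland–Wu.

## References

* T. Kennedy, S. Rychkov, *Tensor RG approach to high-temperature fixed point*, J. Stat. Phys. 187
  (2022), arXiv:2107.11464, §1 (pp. 2–3: partition-function-preserving RG maps), §2 (p. 4:
  Hilbert–Schmidt tensors, normalisation by a scalar). [KennedyRychkov2022]
* N. Ebel, T. Kennedy, S. Rychkov, *Tensor renormalization group meets computer assistance*,
  arXiv:2506.03247 (2025), §2.1–2.2 (HS tensors; "the defining property of any RG map"; the
  `𝒩`-factor). [EbelKennedyRychkov2025]
* S. Iino, S. Morita, N. Kawashima, *Boundary tensor renormalization group*, Phys. Rev. B 100,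
  035449 (2019), arXiv:1905.02351, §2.1 (rank-three boundary tensors on open edges, pairs of adjacent
  boundary tensors renormalised into one alongside the bulk HOTRG step). [IinoMoritaKawashima2019]
* T. Nishino, K. Okunishi, *Corner transfer matrix renormalization group method*, J. Phys. Soc. Jpn.
  65 (1996) 891–894, arXiv:cond-mat/9507087, Eq. (5)–(9) (corner transfer matrices and half-row
  tensors, their renormalisation). [NishinoOkunishi1996]
* R. J. Baxter, *Corner transfer matrices of the eight-vertex model. I*, J. Stat. Phys. 15 (1976).
  [Baxter1976]
* J. L. Cardy, *Critical percolation in finite geometries*, J. Phys. A 25 (1992) L201,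
  arXiv:hep-th/9111026 (crossing probabilities of a rectangle as ratios of partition functions with
  boundary-condition-changing operators at the corners). [CardyJPhysA1992]
* R. Bondesan, J. L. Jacobsen, H. Saleur, *Rectangular amplitudes, conformal blocks, and applications
  to loop models*, Nucl. Phys. B 867 (2013) 913–949, arXiv:1207.7005. [BondesanJacobsenSaleur2012]
-/

noncomputable section

open scoped BigOperators

namespace Literature.MathematicalPhysics.StatisticalMechanics

/-! ### Three-leg (boundary) and two-leg (corner) Hilbert–Schmidt tensors -/

/-- Index set of a three-leg boundary tensor with legs valued in `V = ℓ²(ℕ)`, ordered (previous slot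
along the side, next slot along the side, into the bulk). [cite: IinoMoritaKawashima2019, §2.1 (rank-three boundary tensors)] -/
abbrev ThreeIndex : Type := ℕ × ℕ × ℕ

/-- **Hilbert–Schmidt three-leg (boundary) tensors**: the real Hilbert space `ℓ²(ℕ³)` of arrays
`B_{ijk}` with `∑ B_{ijk}² < ∞` — the rank-three tensors "which respectively represent the … open
edges" of Iino–Morita–Kawashima, in the infinite-index Hilbert–Schmidt setting of Kennedy–Rychkov
(KR 2022, §2: "For tensors with any number of indices we will use the Hilbert–Schmidt norm").
Mathlib's `lp _ 2`. [cite: IinoMoritaKawashima2019, §2.1; KennedyRychkov2022, §2 (p. 4)] -/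
abbrev ThreeTensor : Type := lp (fun _ : ThreeIndex => ℝ) 2

/-- Index set of a two-leg corner tensor, legs ordered (bond along the horizontal side, bond along
the vertical side). [cite: NishinoOkunishi1996, Eq. (5)–(7) (corner transfer matrix)] -/
abbrev TwoIndex : Type := ℕ × ℕ

/-- **Hilbert–Schmidt two-leg (corner) tensors**: the real Hilbert space `ℓ²(ℕ²)` — Baxter's corner
transfer matrices / the CTMRG corner matrix ("the Boltzmann weight for a quadrant (or corner) of the
2D lattice", Nishino–Okunishi 1996), in the Hilbert–Schmidt setting. Mathlib's `lp _ 2`.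
[cite: NishinoOkunishi1996, Eq. (5)–(7); Baxter1976] -/
abbrev TwoTensor : Type := lp (fun _ : TwoIndex => ℝ) 2

/-! ### Open-rectangle networks -/

/-- The bonds of the open `m × n` rectangle network, i.e. the edges of the `(m+2) × (n+2)` grid
`Fin (m+2) × Fin (n+2)` (bulk sites at the interior nodes `(i+1, j+1)`, boundary slots at the
non-corner boundary nodes, corners at the corner nodes): `Sum.inl (a, b)` is the horizontal bond
joining the nodes `(a, b)` and `(a+1, b)`, `Sum.inr (a, b)` the vertical bond joining `(a, b)` and
`(a, b+1)`. [folklore] -/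
abbrev RectEdge (m n : ℕ) : Type := (Fin (m + 1) × Fin (n + 2)) ⊕ (Fin (m + 2) × Fin (n + 1))

section Legs

variable {m n : ℕ}

/-- Legs (left, right, down, up) of the bulk site `(i, j)` (grid node `(i+1, j+1)`) in the bond
configuration `e`: the horizontal bonds `(i, j+1)`, `(i+1, j+1)` and the vertical bonds `(i+1, j)`,
`(i+1, j+1)`. [folklore] -/
def bulkLegs (e : RectEdge m n → ℕ) (s : Fin m × Fin n) : FourIndex :=
  (e (Sum.inl (s.1.castSucc, s.2.succ.castSucc)), e (Sum.inl (s.1.succ, s.2.succ.castSucc)),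
    e (Sum.inr (s.1.succ.castSucc, s.2.castSucc)), e (Sum.inr (s.1.succ.castSucc, s.2.succ)))

/-- Legs (down, up, bulk) of the left boundary slot `j` (grid node `(0, j+1)`): vertical bonds
`(0, j)`, `(0, j+1)`, horizontal bond `(0, j+1)`. [folklore] -/
def leftLegs (e : RectEdge m n → ℕ) (j : Fin n) : ThreeIndex :=
  (e (Sum.inr (0, j.castSucc)), e (Sum.inr (0, j.succ)), e (Sum.inl (0, j.succ.castSucc)))

/-- Legs (down, up, bulk) of the right boundary slot `j` (grid node `(m+1, j+1)`): vertical bonds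
`(m+1, j)`, `(m+1, j+1)`, horizontal bond `(m, j+1)`. [folklore] -/
def rightLegs (e : RectEdge m n → ℕ) (j : Fin n) : ThreeIndex :=
  (e (Sum.inr (Fin.last (m + 1), j.castSucc)), e (Sum.inr (Fin.last (m + 1), j.succ)),
    e (Sum.inl (Fin.last m, j.succ.castSucc)))

/-- Legs (left, right, bulk) of the bottom boundary slot `i` (grid node `(i+1, 0)`): horizontal
bonds `(i, 0)`, `(i+1, 0)`, vertical bond `(i+1, 0)`. [folklore] -/
def bottomLegs (e : RectEdge m n → ℕ) (i : Fin m) : ThreeIndex :=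
  (e (Sum.inl (i.castSucc, 0)), e (Sum.inl (i.succ, 0)), e (Sum.inr (i.succ.castSucc, 0)))

/-- Legs (left, right, bulk) of the top boundary slot `i` (grid node `(i+1, n+1)`): horizontal bonds
`(i, n+1)`, `(i+1, n+1)`, vertical bond `(i+1, n)`. [folklore] -/
def topLegs (e : RectEdge m n → ℕ) (i : Fin m) : ThreeIndex :=
  (e (Sum.inl (i.castSucc, Fin.last (n + 1))), e (Sum.inl (i.succ, Fin.last (n + 1))),
    e (Sum.inr (i.succ.castSucc, Fin.last n)))

/-- Legs (horizontal bond, vertical bond) of the four corners (bottom-left `(0,0)`, bottom-right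
`(m+1, 0)`, top-left `(0, n+1)`, top-right `(m+1, n+1)`), indexed `0, 1, 2, 3`. [folklore] -/
def cornerLegs (e : RectEdge m n → ℕ) : Fin 4 → TwoIndex :=
  ![(e (Sum.inl (0, 0)), e (Sum.inr (0, 0))),
    (e (Sum.inl (Fin.last m, 0)), e (Sum.inr (Fin.last (m + 1), 0))),
    (e (Sum.inl (0, Fin.last (n + 1))), e (Sum.inr (0, Fin.last n))),
    (e (Sum.inl (Fin.last m, Fin.last (n + 1))), e (Sum.inr (Fin.last (m + 1), Fin.last n)))]

end Legs

/-- The weight of the open `m × n` rectangle network at the bond configuration `e`: the weight factor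
`∏_bonds (w (e b))⁻¹` of the weighted Hilbert–Schmidt dictionary (as in `torusTerm`), times the
product over the bulk sites of the entries of `T`, over the slots of each side `s` of the entries of
`B s` (sides (left, right, bottom, top) `= (0, 1, 2, 3)`), and over the corners `c` of the entries of
`K c` (corners (BL, BR, TL, TR) `= (0, 1, 2, 3)`); every bond index occurs in exactly two factors.
[folklore] -/
def rectTerm (w : ℕ → ℝ) (m n : ℕ) (T : FourTensor) (B : Fin 4 → ThreeTensor)
    (K : Fin 4 → TwoTensor) (e : RectEdge m n → ℕ) : ℝ :=
  (∏ b : RectEdge m n, (w (e b))⁻¹) *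
    ((∏ s : Fin m × Fin n, (T : FourIndex → ℝ) (bulkLegs e s)) *
      ((∏ j : Fin n, (B 0 : ThreeIndex → ℝ) (leftLegs e j)) *
        (∏ j : Fin n, (B 1 : ThreeIndex → ℝ) (rightLegs e j)) *
        (∏ i : Fin m, (B 2 : ThreeIndex → ℝ) (bottomLegs e i)) *
        (∏ i : Fin m, (B 3 : ThreeIndex → ℝ) (topLegs e i))) *
      ∏ c : Fin 4, (K c : TwoIndex → ℝ) (cornerLegs e c))

/-- **The partition function of the open `m × n` rectangle network** with bulk tensor `T`, boundary
tensors `B` (one per side) and corner tensors `K`: `Z_{m × n}(T, B, K) = ∑_{e : bonds → ℕ} rectTerm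
w m n T B K e` — the object whose ratios give rectangle crossing probabilities (Cardy 1992) and
rectangular amplitudes (Bondesan–Jacobsen–Saleur). Unconditional sum `tsum` (`= 0` where the family
is not summable; for Hilbert–Schmidt data it is expected to be absolutely convergent by
Cauchy–Schwarz along the bonds, since no tensor of an open rectangle contracts two of its own legs,
cf. the torus case of side `≥ 2` in EKR 2025 §2.2 — not proved here).
[cite: IinoMoritaKawashima2019, §2.1 (open-boundary tensor network with rank-three edge tensors); NishinoOkunishi1996, Eq. (5)–(7) (corners)] -/
def rectPartition (w : ℕ → ℝ) (m n : ℕ) (T : FourTensor) (B : Fin 4 → ThreeTensor)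
    (K : Fin 4 → TwoTensor) : ℝ :=
  ∑' e : RectEdge m n → ℕ, rectTerm w m n T B K e

/-! ### Elementary properties of rectangle networks -/

section Basic

variable (w : ℕ → ℝ) {m n : ℕ}

/-- The rectangle weight of the zero bulk tensor vanishes as soon as there is a bulk site.
[folklore] -/
theorem rectTerm_zero_bulk (hm : m ≠ 0) (hn : n ≠ 0) (B : Fin 4 → ThreeTensor)
    (K : Fin 4 → TwoTensor) (e : RectEdge m n → ℕ) : rectTerm w m n 0 B K e = 0 := by
  haveI : NeZero m := ⟨hm⟩
  haveI : NeZero n := ⟨hn⟩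
  have h : ∏ s : Fin m × Fin n, ((0 : FourTensor) : FourIndex → ℝ) (bulkLegs e s) = 0 :=
    Finset.prod_eq_zero (Finset.mem_univ ((0 : Fin m), (0 : Fin n))) (by simp)
  rw [rectTerm, h, zero_mul, zero_mul, mul_zero]

/-- The rectangle partition function of the zero bulk tensor vanishes (`m, n ≠ 0`). [folklore] -/
theorem rectPartition_zero_bulk (hm : m ≠ 0) (hn : n ≠ 0) (B : Fin 4 → ThreeTensor)
    (K : Fin 4 → TwoTensor) : rectPartition w m n 0 B K = 0 := by
  simp [rectPartition, rectTerm_zero_bulk w hm hn]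

/-- On the empty rectangle (`m = n = 0`: no bulk site, no boundary slot) the weight is the weight
factor times the cyclic contraction of the four corner tensors. [folklore] -/
theorem rectTerm_zero_zero (T : FourTensor) (B : Fin 4 → ThreeTensor) (K : Fin 4 → TwoTensor)
    (e : RectEdge 0 0 → ℕ) :
    rectTerm w 0 0 T B K e =
      (∏ b : RectEdge 0 0, (w (e b))⁻¹) * ∏ c : Fin 4, (K c : TwoIndex → ℝ) (cornerLegs e c) := by
  simp [rectTerm]

/-- **Homogeneity in the bulk tensor**: scaling `T` by `a` scales the rectangle weight by
`a ^ (m * n)` (one factor per bulk site). [folklore] -/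
theorem rectTerm_smul_bulk (a : ℝ) (T : FourTensor) (B : Fin 4 → ThreeTensor)
    (K : Fin 4 → TwoTensor) (e : RectEdge m n → ℕ) :
    rectTerm w m n (a • T) B K e = a ^ (m * n) * rectTerm w m n T B K e := by
  simp only [rectTerm, lp.coeFn_smul, Pi.smul_apply, smul_eq_mul, Finset.prod_mul_distrib,
    Finset.prod_const, Finset.card_univ, Fintype.card_prod, Fintype.card_fin]
  ring

/-- **Homogeneity in the bulk tensor**: `Z_{m×n}(a • T, B, K) = a^{m n} · Z_{m×n}(T, B, K)`.
[folklore] -/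
theorem rectPartition_smul_bulk (a : ℝ) (T : FourTensor) (B : Fin 4 → ThreeTensor)
    (K : Fin 4 → TwoTensor) :
    rectPartition w m n (a • T) B K = a ^ (m * n) * rectPartition w m n T B K := by
  simp only [rectPartition, rectTerm_smul_bulk, tsum_mul_left]

/-- **Ratios are blind to the bulk normalisation**: a ratio of two rectangle partition functions
with the same bulk tensor and different boundary/corner data (a crossing probability is such a
ratio) is unchanged when the bulk tensor is rescaled by `a ≠ 0`. [folklore] -/
theorem rectPartition_smul_bulk_div {a : ℝ} (ha : a ≠ 0) (T : FourTensor)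
    (B B' : Fin 4 → ThreeTensor) (K K' : Fin 4 → TwoTensor) :
    rectPartition w m n (a • T) B K / rectPartition w m n (a • T) B' K' =
      rectPartition w m n T B K / rectPartition w m n T B' K' := by
  rw [rectPartition_smul_bulk, rectPartition_smul_bulk,
    mul_div_mul_left _ _ (pow_ne_zero _ ha)]

end Basic

/-! ### Sides, corners and the data of a boundary RG step -/

/-- Number of boundary slots on each side of the `m × n` rectangle: `n` on the left and right sides
(`0, 1`), `m` on the bottom and top sides (`2, 3`). [folklore] -/
def sideLength (m n : ℕ) : Fin 4 → ℕ := ![n, n, m, m]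

/-- The left side has `n` slots. [folklore] -/
@[simp] theorem sideLength_zero (m n : ℕ) : sideLength m n 0 = n := rfl
/-- The right side has `n` slots. [folklore] -/
@[simp] theorem sideLength_one (m n : ℕ) : sideLength m n 1 = n := rfl
/-- The bottom side has `m` slots. [folklore] -/
@[simp] theorem sideLength_two (m n : ℕ) : sideLength m n 2 = m := rfl
/-- The top side has `m` slots. [folklore] -/
@[simp] theorem sideLength_three (m n : ℕ) : sideLength m n 3 = m := rfl

/-- The horizontal side (bottom `2` / top `3`) adjacent to each corner (BL, BR, TL, TR). [folklore] -/
def cornerHSide : Fin 4 → Fin 4 := ![2, 2, 3, 3]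

/-- The vertical side (left `0` / right `1`) adjacent to each corner (BL, BR, TL, TR). [folklore] -/
def cornerVSide : Fin 4 → Fin 4 := ![0, 1, 0, 1]

/-- **Homogeneity in the boundary tensors**: scaling the boundary tensor of side `s` by `a s`
scales the rectangle weight by `∏ₛ (a s) ^ sideLength m n s` (one factor per slot). [folklore] -/
theorem rectTerm_smul_boundary (w : ℕ → ℝ) {m n : ℕ} (a : Fin 4 → ℝ) (T : FourTensor)
    (B : Fin 4 → ThreeTensor) (K : Fin 4 → TwoTensor) (e : RectEdge m n → ℕ) :
    rectTerm w m n T (fun s => a s • B s) K e =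
      (∏ s, a s ^ sideLength m n s) * rectTerm w m n T B K e := by
  simp only [rectTerm, lp.coeFn_smul, Pi.smul_apply, smul_eq_mul, Finset.prod_mul_distrib,
    Finset.prod_const, Finset.card_univ, Fintype.card_fin, Fin.prod_univ_four, sideLength_zero,
    sideLength_one, sideLength_two, sideLength_three]
  ring

/-- **Homogeneity in the boundary tensors** for the partition function. [folklore] -/
theorem rectPartition_smul_boundary (w : ℕ → ℝ) {m n : ℕ} (a : Fin 4 → ℝ) (T : FourTensor)
    (B : Fin 4 → ThreeTensor) (K : Fin 4 → TwoTensor) :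
    rectPartition w m n T (fun s => a s • B s) K =
      (∏ s, a s ^ sideLength m n s) * rectPartition w m n T B K := by
  simp only [rectPartition, rectTerm_smul_boundary, tsum_mul_left]

/-- **Homogeneity in the corner tensors**: scaling the corner tensor `c` by `a c` scales the
rectangle weight by `∏_c a c`. [folklore] -/
theorem rectTerm_smul_corner (w : ℕ → ℝ) {m n : ℕ} (a : Fin 4 → ℝ) (T : FourTensor)
    (B : Fin 4 → ThreeTensor) (K : Fin 4 → TwoTensor) (e : RectEdge m n → ℕ) :
    rectTerm w m n T B (fun c => a c • K c) e = (∏ c, a c) * rectTerm w m n T B K e := by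
  simp only [rectTerm, lp.coeFn_smul, Pi.smul_apply, smul_eq_mul, Finset.prod_mul_distrib]
  ring

/-- **Homogeneity in the corner tensors** for the partition function. [folklore] -/
theorem rectPartition_smul_corner (w : ℕ → ℝ) {m n : ℕ} (a : Fin 4 → ℝ) (T : FourTensor)
    (B : Fin 4 → ThreeTensor) (K : Fin 4 → TwoTensor) :
    rectPartition w m n T B (fun c => a c • K c) = (∏ c, a c) * rectPartition w m n T B K := by
  simp only [rectPartition, rectTerm_smul_corner, tsum_mul_left]

/-- Input of a boundary RG map: (bulk tensor, boundary tensor of the side). [folklore] -/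
abbrev SideInput : Type := FourTensor × ThreeTensor

/-- Input of a corner RG map: (bulk tensor, boundary tensor of the adjacent horizontal side,
boundary tensor of the adjacent vertical side, corner tensor). [folklore] -/
abbrev CornerInput : Type := FourTensor × ThreeTensor × ThreeTensor × TwoTensor

/-- The full data of an open-rectangle network up to its size: (bulk tensor, the four boundary
tensors, the four corner tensors) — the state space on which a boundary RG map is iterated.
[folklore] -/
abbrev RectTensors : Type := FourTensor × (Fin 4 → ThreeTensor) × (Fin 4 → TwoTensor)

namespace RectTensors

/-- The input of the boundary map of side `s` read off a state. [folklore] -/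
def sideInput (X : RectTensors) (s : Fin 4) : SideInput := (X.1, X.2.1 s)

/-- The input of the corner map of corner `c` read off a state: the bulk tensor, the boundary
tensors of the two sides adjacent to `c`, and the corner tensor `c`. [folklore] -/
def cornerInput (X : RectTensors) (c : Fin 4) : CornerInput :=
  (X.1, X.2.1 (cornerHSide c), X.2.1 (cornerVSide c), X.2.2 c)

/-- The rectangle partition function of a state. [folklore] -/
def partition (w : ℕ → ℝ) (m n : ℕ) (X : RectTensors) : ℝ := rectPartition w m n X.1 X.2.1 X.2.2

/-- `sideInput` of an explicit triple. [folklore] -/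
@[simp] theorem sideInput_mk (T : FourTensor) (B : Fin 4 → ThreeTensor) (K : Fin 4 → TwoTensor)
    (s : Fin 4) : sideInput (T, B, K) s = (T, B s) := rfl

/-- `cornerInput` of an explicit triple. [folklore] -/
@[simp] theorem cornerInput_mk (T : FourTensor) (B : Fin 4 → ThreeTensor) (K : Fin 4 → TwoTensor)
    (c : Fin 4) : cornerInput (T, B, K) c = (T, B (cornerHSide c), B (cornerVSide c), K c) := rfl

/-- `partition` of an explicit triple is `rectPartition`. [folklore] -/
@[simp] theorem partition_mk (w : ℕ → ℝ) (m n : ℕ) (T : FourTensor) (B : Fin 4 → ThreeTensor)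
    (K : Fin 4 → TwoTensor) : partition w m n (T, B, K) = rectPartition w m n T B K := rfl

end RectTensors

/-! ### The interface -/

/-- **A Kennedy–Rychkov-type tensor RG map with boundaries and corners (interface).** Extends
`TensorRGMap w ρ` (bulk: open `domain`, `map = 𝓡`, positive `normalization = 𝒩`, exact covariance of
torus partition functions, `ρ`-equivariance, `C¹`) by the data renormalising OPEN rectangles:
(i) for each side `s` (left, right, bottom, top `= 0, 1, 2, 3`) an open `bdomain s ⊆ SideInput`, the
**boundary map** `bmap s : SideInput → ThreeTensor` — the coarse boundary tensor of side `s` obtained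
from a pair of adjacent fine boundary tensors `B s` and the adjacent bulk `T` (IMK 2019, §2.1: "every
two tensors … neighbouring is renormalized into one tensor"), a function of `(T, B s)` since the fine
boundary data are uniform along the side — and a scalar `bnormalization s`, positive on `bdomain s`;
(ii) for each corner `c` (BL, BR, TL, TR `= 0, 1, 2, 3`) an open `cdomain c ⊆ CornerInput`, the
**corner map** `cmap c` (coarse corner from the bulk, the boundary tensors of the two adjacent sides
`cornerHSide c`, `cornerVSide c`, and the fine corner; cf. the CTMRG corner renormalisation,
Nishino–Okunishi 1996, Eq. (6)–(8)) and a positive scalar `cnormalization c`;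
(iii) **exact covariance of open-rectangle partition functions under `2 × 2` blocking**: for
`m, n ≥ 1`, `T ∈ domain`, `(T, B s) ∈ bdomain s` for all `s` and corner inputs in `cdomain c` for
all `c`, `Z_{2m × 2n}(T, B, K) = 𝒩(T)^{m n} · (∏ₛ 𝒩ₛ(T, B s)^{sideLength m n s}) · (∏_c 𝒩_c(…)) ·
Z_{m × n}(𝓡 T, (bmap s (T, B s))ₛ, (cmap c (…))_c)` — the exponents count coarse bulk sites,
coarse slots per side and corners ("that `Z` remains the same while the total number of tensors in
the network gets reduced is the defining property of any RG map", EKR 2025 §2.2; KR 2022 §1);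
(iv) **`C¹` regularity** of `bmap s` on `bdomain s` and of `cmap c` on `cdomain c`.
No `ρ`-equivariance is demanded of the boundary data (module docstring). This is an INTERFACE
(hypothesis structure): its inhabitation along the six-vertex/percolation orbit is the open crux
`BoundaryTwistTensors` (stmt-CriticalPhenomena-7100); `TensorRGBoundaryMap.empty` shows the axioms
are consistent. [cite: IinoMoritaKawashima2019, §2.1 (boundary tensor RG: rank-three edge tensors blocked in pairs with the bulk); KennedyRychkov2022, §1–2 (exactly partition-function-preserving RG on Hilbert–Schmidt tensors, scalar normalisation); EbelKennedyRychkov2025, §2.2; NishinoOkunishi1996, Eq. (6)–(8) (corner renormalisation); interface posited by route CardyTensorRG] -/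
structure TensorRGBoundaryMap (w : ℕ → ℝ) {G : Type*} [Group G]
    (ρ : Representation ℝ G FourTensor) extends TensorRGMap w ρ where
  /-- The domain of the boundary map of side `s`: pairs (bulk tensor, boundary tensor of side `s`). -/
  bdomain : Fin 4 → Set SideInput
  /-- Each boundary domain is open. -/
  isOpen_bdomain : ∀ s, IsOpen (bdomain s)
  /-- The boundary RG map of side `s` (a total function; only its values on `bdomain s` matter). -/
  bmap : Fin 4 → SideInput → ThreeTensor
  /-- The scalar normalisation `𝒩ₛ` of the coarse boundary tensor of side `s`. -/
  bnormalization : Fin 4 → SideInput → ℝ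
  /-- `𝒩ₛ > 0` on the boundary domain. -/
  bnormalization_pos : ∀ s, ∀ p ∈ bdomain s, 0 < bnormalization s p
  /-- The domain of the corner map of corner `c`: quadruples (bulk, boundary tensor of the adjacent
  horizontal side, boundary tensor of the adjacent vertical side, corner tensor). -/
  cdomain : Fin 4 → Set CornerInput
  /-- Each corner domain is open. -/
  isOpen_cdomain : ∀ c, IsOpen (cdomain c)
  /-- The corner RG map of corner `c` (a total function; only its values on `cdomain c` matter). -/
  cmap : Fin 4 → CornerInput → TwoTensor
  /-- The scalar normalisation `𝒩_c` of the coarse corner tensor `c`. -/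
  cnormalization : Fin 4 → CornerInput → ℝ
  /-- `𝒩_c > 0` on the corner domain. -/
  cnormalization_pos : ∀ c, ∀ q ∈ cdomain c, 0 < cnormalization c q
  /-- Exact covariance of open-rectangle partition functions under `2 × 2` blocking: for
  `m, n ≥ 1` and data in the domains, `Z_{2m×2n}(T, B, K) = 𝒩(T)^{mn} · ∏ₛ 𝒩ₛ^{sideLength m n s} ·
  ∏_c 𝒩_c · Z_{m×n}(𝓡 T, bmap, cmap)`. -/
  bcovariance : ∀ m n : ℕ, 1 ≤ m → 1 ≤ n →
    ∀ (T : FourTensor) (B : Fin 4 → ThreeTensor) (K : Fin 4 → TwoTensor), T ∈ domain →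
      (∀ s, (T, B s) ∈ bdomain s) →
      (∀ c, (T, B (cornerHSide c), B (cornerVSide c), K c) ∈ cdomain c) →
      rectPartition w (2 * m) (2 * n) T B K =
        normalization T ^ (m * n) *
          (∏ s, bnormalization s (T, B s) ^ sideLength m n s) *
          (∏ c, cnormalization c (T, B (cornerHSide c), B (cornerVSide c), K c)) *
          rectPartition w m n (map T) (fun s => bmap s (T, B s))
            (fun c => cmap c (T, B (cornerHSide c), B (cornerVSide c), K c))
  /-- Each boundary map is continuously Fréchet-differentiable on its domain (jointly in the bulk
  and boundary tensors). -/
  bcontDiffOn : ∀ s, ContDiffOn ℝ 1 (bmap s) (bdomain s)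
  /-- Each corner map is continuously Fréchet-differentiable on its domain. -/
  ccontDiffOn : ∀ c, ContDiffOn ℝ 1 (cmap c) (cdomain c)

namespace TensorRGBoundaryMap

variable {w : ℕ → ℝ} {G : Type*} [Group G] {ρ : Representation ℝ G FourTensor}

/-- **Consistency of the axioms**: for any weight `≥ 1` and any action, the structure with EMPTY
bulk, boundary and corner domains (identity-like maps, normalisations `1`) is a
`TensorRGBoundaryMap` — all axioms are then vacuous. The content of the notion is entirely in the
size of the domains (the crux `BoundaryTwistTensors` asks for domains containing the RG orbit of the
six-vertex boundary data of percolation). [folklore] -/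
def empty (hw : ∀ i, 1 ≤ w i) : TensorRGBoundaryMap w ρ :=
  { TensorRGMap.empty hw with
    bdomain := fun _ => ∅
    isOpen_bdomain := fun _ => isOpen_empty
    bmap := fun _ p => p.2
    bnormalization := fun _ _ => 1
    bnormalization_pos := fun _ p h => (Set.notMem_empty p h).elim
    cdomain := fun _ => ∅
    isOpen_cdomain := fun _ => isOpen_empty
    cmap := fun _ q => q.2.2.2
    cnormalization := fun _ _ => 1
    cnormalization_pos := fun _ q h => (Set.notMem_empty q h).elim
    bcovariance := fun _ _ _ _ T _ _ hT _ _ => (Set.notMem_empty T hT).elim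
    bcontDiffOn := fun _ => contDiff_snd.contDiffOn
    ccontDiffOn := fun _ => contDiff_snd.snd.snd.contDiffOn }

/-- The bulk part of the empty boundary RG map is the empty bulk RG map. [folklore] -/
theorem empty_toTensorRGMap (hw : ∀ i, 1 ≤ w i) :
    (empty (ρ := ρ) hw).toTensorRGMap = TensorRGMap.empty hw := rfl

variable (R : TensorRGBoundaryMap w ρ)

/-- **One boundary RG step on states**: `(T, B, K) ↦ (𝓡 T, (bmap s (T, B s))ₛ, (cmap c (T,
B (cornerHSide c), B (cornerVSide c), K c))_c)` — the map iterated along the RG orbit. [folklore] -/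
def step (X : RectTensors) : RectTensors :=
  (R.map X.1, fun s => R.bmap s (X.sideInput s), fun c => R.cmap c (X.cornerInput c))

/-- A state is in the domain of the boundary RG map: bulk tensor in `domain`, every side input in
its `bdomain`, every corner input in its `cdomain`. [folklore] -/
def InDomain (X : RectTensors) : Prop :=
  X.1 ∈ R.domain ∧ (∀ s, X.sideInput s ∈ R.bdomain s) ∧ ∀ c, X.cornerInput c ∈ R.cdomain c

/-- The boundary-and-corner part of the scalar factor of one `2 × 2` blocking of the `2m × 2n`
rectangle: `∏ₛ 𝒩ₛ(T, B s)^{sideLength m n s} · ∏_c 𝒩_c(…)`. [folklore] -/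
def bcFactor (m n : ℕ) (X : RectTensors) : ℝ :=
  (∏ s, R.bnormalization s (X.sideInput s) ^ sideLength m n s) *
    ∏ c, R.cnormalization c (X.cornerInput c)

/-- The full scalar factor of one `2 × 2` blocking of the `2m × 2n` rectangle:
`𝒩(T)^{m n} · bcFactor`. [folklore] -/
def factor (m n : ℕ) (X : RectTensors) : ℝ :=
  R.normalization X.1 ^ (m * n) * R.bcFactor m n X

/-- The bulk component of a step is `𝓡`. [folklore] -/
@[simp] theorem step_fst (X : RectTensors) : (R.step X).1 = R.map X.1 := rfl

/-- The boundary components of a step are the `bmap`s. [folklore] -/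
@[simp] theorem step_snd_fst (X : RectTensors) (s : Fin 4) :
    (R.step X).2.1 s = R.bmap s (X.sideInput s) := rfl

/-- The corner components of a step are the `cmap`s. [folklore] -/
@[simp] theorem step_snd_snd (X : RectTensors) (c : Fin 4) :
    (R.step X).2.2 c = R.cmap c (X.cornerInput c) := rfl

/-- The boundary-and-corner factor is positive on the domain. [folklore] -/
theorem bcFactor_pos (m n : ℕ) {X : RectTensors} (hX : R.InDomain X) : 0 < R.bcFactor m n X :=
  mul_pos (Finset.prod_pos fun s _ => pow_pos (R.bnormalization_pos s _ (hX.2.1 s)) _)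
    (Finset.prod_pos fun c _ => R.cnormalization_pos c _ (hX.2.2 c))

/-- The full blocking factor is positive on the domain. [folklore] -/
theorem factor_pos (m n : ℕ) {X : RectTensors} (hX : R.InDomain X) : 0 < R.factor m n X :=
  mul_pos (pow_pos (R.normalization_pos _ hX.1) _) (R.bcFactor_pos m n hX)

/-- **Covariance, state form**: for `m, n ≥ 1` and a state `X` in the domain,
`Z_{2m × 2n}(X) = factor m n X · Z_{m × n}(step X)`. [folklore] -/
theorem covariance_step {m n : ℕ} (hm : 1 ≤ m) (hn : 1 ≤ n) {X : RectTensors} (hX : R.InDomain X) :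
    X.partition w (2 * m) (2 * n) = R.factor m n X * (R.step X).partition w m n := by
  obtain ⟨T, B, K⟩ := X
  obtain ⟨hT, hB, hK⟩ := hX
  simp only [RectTensors.sideInput_mk, RectTensors.cornerInput_mk] at hB hK
  simp only [RectTensors.partition, factor, bcFactor, step, RectTensors.sideInput_mk, RectTensors.cornerInput_mk]
  rw [R.bcovariance m n hm hn T B K hT hB hK]
  ring

/-- A step from a state in the domain keeps the coarse partition function tied to the fine one:
`Z_{m × n}(step X) = Z_{2m × 2n}(X) / factor m n X`. [folklore] -/
theorem partition_step {m n : ℕ} (hm : 1 ≤ m) (hn : 1 ≤ n) {X : RectTensors} (hX : R.InDomain X) :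
    (R.step X).partition w m n = X.partition w (2 * m) (2 * n) / R.factor m n X := by
  rw [R.covariance_step hm hn hX, mul_div_cancel_left₀ _ (R.factor_pos m n hX).ne']

/-- **The bulk normalisation cancels in ratios.** For two states with the SAME bulk tensor `T` and
different boundary/corner data, both in the domain, the ratio of their `2m × 2n` partition
functions equals the ratio of (boundary-and-corner factor × coarse partition function): the bulk
factor `𝒩(T)^{m n}` drops out. Crossing probabilities are such ratios, which is why only the
boundary/corner normalisations — not `𝒩` — enter their RG analysis. [folklore] -/
theorem covariance_ratio {m n : ℕ} (hm : 1 ≤ m) (hn : 1 ≤ n) {T : FourTensor}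
    {B B' : Fin 4 → ThreeTensor} {K K' : Fin 4 → TwoTensor} (hX : R.InDomain (T, B, K))
    (hX' : R.InDomain (T, B', K')) :
    rectPartition w (2 * m) (2 * n) T B K / rectPartition w (2 * m) (2 * n) T B' K' =
      (R.bcFactor m n (T, B, K) * (R.step (T, B, K)).partition w m n) /
        (R.bcFactor m n (T, B', K') * (R.step (T, B', K')).partition w m n) := by
  have h₁ := R.covariance_step hm hn hX
  have h₂ := R.covariance_step hm hn hX'
  simp only [RectTensors.partition_mk, factor] at h₁ h₂
  rw [h₁, h₂, mul_assoc, mul_assoc,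
    mul_div_mul_left _ _ (pow_ne_zero _ (R.normalization_pos T hX.1).ne')]

/-- Each boundary map is continuous on its domain (from `C¹`). [folklore] -/
theorem continuousOn_bmap (s : Fin 4) : ContinuousOn (R.bmap s) (R.bdomain s) :=
  (R.bcontDiffOn s).continuousOn

/-- Each corner map is continuous on its domain (from `C¹`). [folklore] -/
theorem continuousOn_cmap (c : Fin 4) : ContinuousOn (R.cmap c) (R.cdomain c) :=
  (R.ccontDiffOn c).continuousOn

end TensorRGBoundaryMap

end Literature.MathematicalPhysics.StatisticalMechanics

end
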